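import Literature.MathematicalPhysics.QuantumFieldTheory.Balaban1983to89.B9WalkLettersOps310
import Literature.MathematicalPhysics.QuantumFieldTheory.Balaban1983to89.B9WalkLettersBondDom
import Literature.MathematicalPhysics.QuantumFieldTheory.Balaban1983to89.B9WalkLettersOpsFacts
import Literature.MathematicalPhysics.QuantumFieldTheory.Balaban1983to89.B9Thm310WholeRel

/-!
# `Balaban1983to89.B9WalkLettersOps310Facts` — W-b FILE 4 (proofs): THE U-INDEPENDENT LAWS OF THE rows-19 BOND-SECTOR WALK LETTERS AT THE RECORD `ops310WalkYO` —
# `StaticOK310`, `Sizes310.Bounded`, the eleven letter clauses of `Identities310₂` (Leibniz rules + kernel dominations; the four laws `inv ∕ invT ∕ eq3105 ∕ eq3105T` of the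
# generic letters `GA ∕ Δa ∕ Oc ∕ Rf ∕ Rt` enter as HYPOTHESES), `WalkReading310.OKRel`, `Locality310` (from the locality of the generic letters) — the A-side twin of
# `B9WalkLettersOpsFacts` ∕ `B9WalkLettersOpsO` §2 (HOME `pub-ymgap-dag-n06-d/W-b-PLAN.md`)

statement-level skeleton of published theorems with citation tags; proofs where landed; nothing here is a claim about the Yang–Mills mass gap

B9 = T. Bałaban, *Propagators for lattice gauge theories in a background field*, Commun. Math. Phys. **99** (1985) 389–434 [Balaban1985BackgroundPropagators];
[4] = T. Bałaban, *Propagators and renormalization transformations for lattice gauge theories. II*, Commun. Math. Phys. **96** (1984) 223–250 [Balaban1984PropagatorsII].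
THE PRINT.  (3.87)–(3.89) pp. 408–409 (the partition `{h_□}`, «O(M⁻¹)»), (3.100) p. 413 (Leibniz rules), (3.105)–(3.107) pp. 414–416, p. 410 l. 14–15 and p. 413 (locality),
(3.39) ∕ (3.42) p. 397 (the reading of the test functions); [4] (2.36)–(2.46) pp. 229–231, (2.54) p. 233, Lemma 2.1 (2.61) p. 234.
WHAT (N06 certificate, dag-n06-d; rows 19 — the binders `hstA hκA hrdA hlocA` and the letter clauses of `h36A'`'s `Identities310₂` become THEOREMS at the record of W-b FILE 3):
* §1 ★★★ `staticOK310_ops310WalkYO` — `StaticOK310 (ops310WalkYO …) ρ N_c N′ N_F C_ℓ (kappa310WalkY x b)` for `ρ ≥ 3`, `N_c, N′ ≥ walkCntY`, `C_ℓ ≥ L²`, under the LAWS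
  `hβ1 ∕ hlev ∕ hbI0` of def-Y's bond map of record and the thresholds `walkCntM₀Y ≤ M`, `nbrM₀Y … 3 ≤ M⋆`; the factor-localisation count `cntF` of the GENERIC `SF` stays a
  hypothesis (geometry ∕ partition ∕ counts ∕ comparability ∕ the fifteen kernel clauses are this lineage's SITE facts ✓`B9WalkLettersOpsFacts` ∕ ✓`B9WalkLettersKernelsRows`
  VERBATIM — the supports and kernels ARE the site ones);
* §2 ★★ `bounded_kappa310WalkY` — `(kappa310WalkY x b).Bounded K_c` for `K_c ≥ KcWalkY` (the Leibniz half of ✓`bounded_kappaWalkY`);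
* §3 ★★★ `identities310₂_ops310WalkYO_of_laws` — ALL of `B9Thm310WholeDir.Identities310₂` at the record for contraction-pair bond variables: the Leibniz rules
  (✓`B9WalkLettersBondLeib.leibD_coordsB ∕ leibT_coordsB ∕ leibL_coordsB`), the dominations (✓`B9WalkLettersBondDom`), `KPLd_sum` (with equality); the four U-laws
  `inv ∕ invT ∕ eq3105 ∕ eq3105T` of the GENERIC letters are HYPOTHESES `hinv hinvT h3105 h3105T` (print's (3.27) `GΔ_a = I` and (3.105) «Δ_aG₀ = I − R» — at NODE 00's
  instance they are the next pin's content, exactly as `hOloc ∕ hOlocT` on the site side);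
* §4 ★ `okRel_rd310WalkYO` — `WalkReading310.OKRel` of the bond reading in the `RelB` form (✓`B9CoReadingCoords.off_bound_evBK`, under the carrier-faithfulness `hβI` of `bI`);
* §5 ★★ `locality310_ops310WalkYO` — `Locality310` from the LOCALITY OF THE GENERIC LETTERS (`hOc`: configurations agreeing near `□` in the sense of `agree310WalkYO near □`
  give the same cube letter `Oc □`; `hRf`: `AgreeF`-agreeing configurations give the same factor `Rf a` — HYPOTHESES on the letters, print's «G_□ depends on U restricted to
  Ω₀(□)», «R_α(X) depends on U restricted to X̃⁵»).
HONEST SCOPE.  Assembly of landed clauses + bookkeeping; the bond-variable contraction (unitary fibre), the laws of `bI`, the thresholds, the four U-laws and the two locality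
hypotheses stay DISPLAYED; nothing of [B9]'s analysis asserted; no (3.42); count-neutral; N06 NOT discharged; nothing continuum ∕ OS ∕ mass gap ∕ Clay.  Cell `pub-ymgap`
(D-0062), node N06 [B9], rows 19, seat `pub-ymgap-dag-n06-d` (g31), 2026-08-31.  Net new unproved facts: 0.  NEW file.
-/

noncomputable section

namespace Literature.MathematicalPhysics.QuantumFieldTheory.Balaban1983to89.B9WalkLettersOps310Facts

open Node00
open Node00.OpsYNablaBridge (chartY compat_blkSK_blkBK)
open B6KLevelCensusIndexV1 (KIdx)
open B6Ineq2142KLevelV1 (β lvl)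
open B6GlobalChartV1 (PV blkV1)
open B6Cover236MultiLevelBlocks (cubes)
open B6RandomWalk (HasMajorant)
open B6RandomWalkHom (HasMajorantHom hasMajorantHom_iff)
open B9Thm34Ext (toB6)
open B9Thm37Sum (mulOp)
open B9Thm37CubeCoverCommutators (hTY)
open B9Thm310Whole (Ops310 WalkReading310 Sizes310 StaticOK310 Locality310)
open B9Thm310WholeDir (DirLetters310 Identities310₂)
open B9RWSums346SecondDiff (DirOps310)
open B9PinMembersKLevelV1 (MemberY geo9Y)
open B9GeoLemma21KLevelV1 (geo9K_dist_nonneg' geo9Y_dist_comm geo9Y_dist_self geo9Y_dist_triangle geo9Y_len_pos)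
open B9GeoNormsKLevelV1 (geo9K_supNorm_nonneg)
open B9GeoNbrCountKLevelV1 (nbrM₀Y)
open B9CoRealizesRelAtLetters (RelB)
open B9CoReadingCoords (XBK blkBK evBK GcoK DcoK DscoK LcoK off_bound_evBK)
open B9CoReadingCoordsS (XSK blkSK sIK)
open B9WalkLettersCoordsS (SblkY walkCntM₀Y walkCntY sum_indicator_SblkY_le)
open B9WalkLettersKernels (kPDY kCDY kPLY kPLdY kCLY kCLtY sum_kPLdY)
open B9WalkLettersKernelsRows (kernels_nonneg kernels_row_loc kernels_col_loc kernels_dir_loc kPDY_row kCDY_row kPLY_row kCLY_row kCLtY_col)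
open B9WalkLettersOps (kappaWalkY KcWalkY)
open B9WalkLettersOpsFacts (len_le_Lsq_mul_len_of_mem_SblkY ite_congr_dec bounded_kappaWalkY)
open B9WalkLettersBondLeib (mulcoB cdcoB cltcoB plcoB clcoB leibD_coordsB leibT_coordsB leibL_coordsB)
open B9WalkLettersBondDom (hasMajorant_cdcoB_kCDY hasMajorant_cltcoB_kCLtY hasMajorant_plcoB_kPLdY hasMajorant_clcoB_kCLY hasMajorantHom_zero_kPDY)
open B9WalkLettersOps310

variable {d ℓ : ℕ} {hd : 1 ≤ d + 1} {hL : Odd (ℓ + 1) ∧ 1 < ℓ + 1} {b₀ b₁ : ℝ} {Mstar : ℕ}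
variable {𝔸 : Type} [NormedRing 𝔸] [NormedAlgebra ℂ 𝔸] [CompleteSpace 𝔸] [FiniteDimensional ℝ 𝔸] {κ : Type} [Fintype κ] [DecidableEq κ]
variable (x : MemberY d ℓ hd hL b₀ b₁ Mstar) (b : Module.Basis κ ℝ 𝔸) (B : B9.Backgrounds) (cfg : B.Cfg → CfgY 𝔸 x.toKIdx)
variable (bI : FBondY x.toKIdx → IBondY x.toKIdx) [Fintype (geo9Y x).Site] [DecidableEq (geo9Y x).Site]
variable {A : Type} [Fintype A] (GA : BondOpY 𝔸 x.toKIdx) (Oc : ↥(cubes x.toKIdx.D.toDomains) → BondOpY 𝔸 x.toKIdx)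
  (Δa : B.Cfg → Module.End ℝ (XBK κ x.toKIdx → ℝ)) (Rf Rt : B.Cfg → A → Module.End ℝ (XBK κ x.toKIdx → ℝ)) (SF : A → Finset (geo9Y x).Site)

/-! ## §1 `StaticOK310` at the record -/

omit [DecidableEq κ] in
/-- ★★★ **`hstA` AT THE RECORD**: `StaticOK310 (ops310WalkYO …) ρ N_c N′ N_F C_ℓ (kappa310WalkY x b)` for every radius `ρ ≥ 3`, counts `N_c, N′ ≥ walkCntY`, comparability
`C_ℓ ≥ L²`, under the laws `hβ1 ∕ hlev ∕ hbI0` of the bond map, the thresholds `walkCntM₀Y ≤ (geo9Y x).M`, `nbrM₀Y … 3 ≤ M⋆`, and the count `N_F` of the generic factor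
localisations `SF` (a HYPOTHESIS on the parameter). [cite: Balaban1985BackgroundPropagators, (3.87)–(3.89) pp.408–409, p.413; Balaban1984PropagatorsII, (2.36)–(2.46) pp.229–231, (2.54) p.233, Lemma 2.1 (2.61) p.234] -/
theorem staticOK310_ops310WalkYO
    (hβ1 : ∀ f : FBondY x.toKIdx, (B6Geom246MultiLevelTorus.geomT x.D).dist (β x.hN x.D x.hk (bI f)) (blkV1 x.hN x.D f) ≤ 1)
    (hlev : ∀ f : FBondY x.toKIdx, lvl x.hN x.D x.hk (bI f) = (blkV1 x.hN x.D f).1.1)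
    (hbI0 : ∀ (z : Site (PV d ℓ x.m x.K hd hL) 0) (μ : Fin (d + 1)), bI ⟨z, μ⟩ = bI ⟨z, 0⟩)
    (hMw : walkCntM₀Y d ℓ hd hL b₀ b₁ Mstar ≤ (geo9Y x).M) (hM3 : nbrM₀Y d ℓ hd hL b₀ b₁ 3 ≤ Mstar)
    {ρ Nc N' NF Cℓ : ℝ} (hρ : 3 ≤ ρ) (hNc : walkCntY d ℓ hd hL b₀ b₁ Mstar ≤ Nc) (hN' : walkCntY d ℓ hd hL b₀ b₁ Mstar ≤ N') (hCℓ : (((ℓ + 1 : ℕ) : ℝ)) ^ 2 ≤ Cℓ)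
    (hcntF : ∀ a : (geo9Y x).Site, (∑ q, if a ∈ SF q then (1 : ℝ) else 0) ≤ NF) :
    StaticOK310 (ops310WalkYO x b B cfg bI GA Oc Δa Rf Rt SF) ρ Nc N' NF Cℓ (kappa310WalkY x b) := by
  have hnn := fun c μ a y'' => kernels_nonneg x b bI c μ a y''
  have hrl := fun c a y'' => kernels_row_loc x b bI c a y''
  have hcl := fun c y'' a => kernels_col_loc x b bI c y'' a
  exact
    { tri := geo9Y_dist_triangle x
      refl := geo9Y_dist_self x
      symm := geo9Y_dist_comm x
      dnn := geo9K_dist_nonneg' x.toKIdx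
      lenpos := geo9Y_len_pos x
      hh := fun c p => abs_hWalkBY_le_one x c p
      hS := fun c p hp => blkBK_mem_SblkY_of_hWalkBY_ne_zero x bI hbI0 c hp
      hhY := fun c p => abs_hWalkBY_le_one x c p
      hSY := fun c p hp => blkBK_mem_SblkY_of_hWalkBY_ne_zero x bI hbI0 c hp
      cnt := fun a => le_trans (le_of_eq (Finset.sum_congr rfl fun c _ => ite_congr_dec)) ((sum_indicator_SblkY_le x bI hβ1 hMw a).trans hNc)
      cnt' := fun a => le_trans (le_of_eq (Finset.sum_congr rfl fun c _ => ite_congr_dec)) ((sum_indicator_SblkY_le x bI hβ1 hMw a).trans hN')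
      cntF := hcntF
      comp := fun c a a' ha ha' => (len_le_Lsq_mul_len_of_mem_SblkY x bI hlev c ha ha').trans
        (mul_le_mul_of_nonneg_right hCℓ (geo9Y_len_pos x a').le)
      KPD_nonneg := fun c a y'' => (hnn c 0 a y'').2.2.2.2.2.2.2.2.2.2.2
      KPD_loc := fun c a y'' h => ((hrl c a y'').2.2.1 h).trans hρ
      KPD_row := fun c a => (kPDY_row x bI hlev hM3 c a).trans (le_of_eq ite_congr_dec)
      KCD_nonneg := fun c a y'' => (hnn c 0 a y'').2.2.2.2.2.2.2.2.2.1
      KCD_loc := fun c a y'' h => ((hrl c a y'').2.2.2.1 h).trans hρ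
      KCD_row := fun c a => (kCDY_row x b bI hlev hM3 c a).trans (le_of_eq ite_congr_dec)
      KPL_nonneg := fun c a y'' => (hnn c 0 a y'').2.2.2.2.2.1
      KPL_loc := fun c a y'' h => ((hrl c a y'').2.2.2.2.1 h).trans hρ
      KPL_row := fun c a => (kPLY_row x b bI hlev hM3 c a).trans (le_of_eq ite_congr_dec)
      KCL_nonneg := fun c a y'' => (hnn c 0 a y'').2.2.2.2.2.2.2.2.1
      KCL_loc := fun c a y'' h => ((hrl c a y'').2.2.2.2.2 h).trans hρ
      KCL_row := fun c a => (kCLY_row x b bI hlev hM3 c a).trans (le_of_eq ite_congr_dec)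
      KCLt_nonneg := fun c y'' a => (hnn c 0 y'' a).2.2.2.2.2.2.2.2.2.2.1
      KCLt_loc := fun c y'' a h => ((hcl c y'' a).2.2 h).trans hρ
      KCLt_col := fun c a => (kCLtY_col x b bI hlev hM3 c a).trans (le_of_eq ite_congr_dec) }

/-! ## §2 `Sizes310.Bounded` at the record -/

omit [CompleteSpace 𝔸] [DecidableEq κ] [Fintype (geo9Y x).Site] [DecidableEq (geo9Y x).Site] in
/-- ★★ **`hκA` AT THE RECORD**: `(kappa310WalkY x b).Bounded K_c` for `K_c ≥ KcWalkY` — the Leibniz half of this lineage's `bounded_kappaWalkY` (member-uniform numerators,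
`M_h ≥ 1`). [cite: Balaban1985BackgroundPropagators, (3.100) p.413; Balaban1984PropagatorsII, (2.44) p.230] -/
theorem bounded_kappa310WalkY {Kc : ℝ} (hKc : KcWalkY d ℓ hd hL b₀ b₁ b ≤ Kc) : (kappa310WalkY x b).Bounded Kc := by
  have h := bounded_kappaWalkY x b (Cℓ := 0) le_rfl hKc le_rfl
  exact { nonneg := ⟨h.nonneg.kPD, h.nonneg.kCD, h.nonneg.kPL, h.nonneg.kCL, h.nonneg.kCLt⟩, leibD := h.leibD, leibL := h.leibL, leibT := h.leibT }

/-! ## §3 `Identities310₂` at the record, from the four U-laws of the generic letters -/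

omit [DecidableEq κ] [DecidableEq (geo9Y x).Site] in
/-- ★★★ **`Identities310₂` AT THE RECORD**: the Leibniz rules (`leibD ∕ leibT ∕ leibL`, theorems of `B9WalkLettersBondLeib`), the dominations `hPD ∕ hCD ∕ hPL ∕ hCL ∕ hCLt`
(`B9WalkLettersBondDom`, for contraction-pair bond variables and the laws `hβ1 ∕ hbI0` of `bI`) and `KPLd_sum` of `B9Thm310WholeDir.Identities310₂` for
`ops310WalkYO ∕ dirOps310WalkYO ∕ dirLetters310WalkYO`; the four U-LAWS of the generic letters — `GΔ_a = 1`, `Δ_aG = 1` ((3.27)), «Δ_aG₀ = I − R» ((3.105)) and its transpose —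
are HYPOTHESES `hinv hinvT h3105 h3105T` stated at the record's letters. [cite: Balaban1985BackgroundPropagators, (3.100) p.413, (3.105)–(3.106) p.414, (3.87) p.409, (3.27) p.395; Balaban1984PropagatorsII, (2.39)–(2.44) pp.229–230, (2.51) p.232] -/
theorem identities310₂_ops310WalkYO_of_laws (R : ℝ) (H : Prop)
    (hβ1 : ∀ f : FBondY x.toKIdx, (B6Geom246MultiLevelTorus.geomT x.D).dist (β x.hN x.D x.hk (bI f)) (blkV1 x.hN x.D f) ≤ 1)
    (hbI0 : ∀ (z : Site (PV d ℓ x.m x.K hd hL) 0) (μ : Fin (d + 1)), bI ⟨z, μ⟩ = bI ⟨z, 0⟩)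
    (U : B.Cfg)
    (hU : ∀ (μ : Fin (d + 1)) (w : SiteY x.toKIdx), ‖(UboxY x.toKIdx (cfg U) μ w : 𝔸)‖ ≤ 1 ∧ ‖(((UboxY x.toKIdx (cfg U) μ w)⁻¹ : 𝔸ˣ) : 𝔸)‖ ≤ 1)
    (hinv : GcoK x.toKIdx b B cfg GA U * Δa U = 1) (hinvT : Δa U * GcoK x.toKIdx b B cfg GA U = 1)
    (h3105 : Δa U * (∑ c, mulOp (hWalkBY x c) * GcoK x.toKIdx b B cfg (Oc c) U * mulOp (hWalkBY x c)) = 1 - ∑ a, Rf U a)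
    (h3105T : (∑ c, mulOp (hWalkBY x c) * GcoK x.toKIdx b B cfg (Oc c) U * mulOp (hWalkBY x c)) * Δa U = 1 - ∑ a, Rt U a) :
    Identities310₂ (ops310WalkYO x b B cfg bI GA Oc Δa Rf Rt SF) (dirOps310WalkYO x b B cfg bI GA Oc Δa Rf Rt SF)
      (dirLetters310WalkYO x b B cfg bI GA Oc Δa Rf Rt SF) R H U := by
  have hm : ∀ c : ↥(cubes x.toKIdx.D.toDomains), mulOp ((ops310WalkYO x b B cfg bI GA Oc Δa Rf Rt SF).h c) = mulcoB x.toKIdx b (hTY x.toKIdx c) :=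
    fun c => mulOp_hWalkBY_eq_mulcoB x b c
  have hmY : ∀ c : ↥(cubes x.toKIdx.D.toDomains), mulOp ((ops310WalkYO x b B cfg bI GA Oc Δa Rf Rt SF).hY c) = mulcoB x.toKIdx b (hTY x.toKIdx c) :=
    fun c => mulOp_hWalkBY_eq_mulcoB x b c
  exact
    { hPD := fun c => hasMajorantHom_zero_kPDY x R H c
      hCD := fun c => (hasMajorantHom_iff _ _ _).2 (hasMajorant_cdcoB_kCDY x b B cfg R H hβ1 hbI0 c U hU)
      hPL := fun c μ => hasMajorant_plcoB_kPLdY x b B cfg R H hβ1 hbI0 c μ U (hU μ)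
      KPLd_sum := fun c a y'' => le_of_eq (sum_kPLdY x b bI c a y'')
      hCL := fun c => (hasMajorantHom_iff _ _ _).2 (hasMajorant_clcoB_kCLY x b R H hβ1 hbI0 c)
      hCLt := fun c => (hasMajorantHom_iff _ _ _).2 (hasMajorant_cltcoB_kCLtY x b B cfg R H hβ1 hbI0 c U hU)
      leibD := fun c => by rw [hm c, hmY c]; exact leibD_coordsB x.toKIdx b B cfg U (hTY x.toKIdx c)
      leibL := fun c => by rw [hm c]; exact leibL_coordsB x.toKIdx b B cfg U (hTY x.toKIdx c)
      leibT := fun c => by rw [hm c, hmY c]; exact leibT_coordsB x.toKIdx b B cfg U (hTY x.toKIdx c)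
      inv := hinv
      invT := hinvT
      eq3105 := h3105
      eq3105T := h3105T }

/-! ## §4 The bond reading's support clauses -/

omit [Fintype (geo9Y x).Site] [DecidableEq (geo9Y x).Site] [Fintype A] in
/-- ★ **`hrdA` AT THE RECORD** (`RelB` form, node00-def-Y RULING (A) on WORD-W1): the located test functions read through `evBK` vanish off the carrier class of their block and
are bounded by their sup norm — under the carrier-faithfulness `hβI` of the bond map (a LAW of def-Y's `bIOfRecord`). [cite: Balaban1985BackgroundPropagators, (3.39) + (3.42) p.397] -/
theorem okRel_rd310WalkYO (hβI : ∀ (f : FBondY x.toKIdx) (c : IBondY x.toKIdx), blkV1 x.hN x.D f = β x.hN x.D x.hk c → β x.hN x.D x.hk (bI f) = blkV1 x.hN x.D f)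
    (near : ↥(cubes x.toKIdx.D.toDomains) → Finset (SiteY x.toKIdx)) (AgreeF : A → B.Cfg → B.Cfg → Prop) :
    (rd310WalkYO x B cfg (κ := κ) near AgreeF).OKRel (ops310WalkYO x b B cfg bI GA Oc Δa Rf Rt SF).blk (RelB x.toKIdx) :=
  have h := off_bound_evBK (κ := κ) x.toKIdx hβI
  ⟨h.1, h.2, fun lam => geo9K_supNorm_nonneg x.toKIdx lam⟩

/-! ## §5 `Locality310` at the record, from the locality of the generic letters -/

omit [Fintype (geo9Y x).Site] [DecidableEq (geo9Y x).Site] [Fintype A] in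
/-- ★★ **`hlocA` AT THE RECORD**: `Locality310` from the LOCALITY OF THE GENERIC LETTERS — `hOc` (configurations agreeing near `□` give the same cube letter `Oc □`, print's
«G_□ depends on U restricted to Ω₀(□) ⊂ □̃⁵») and `hRf` (`AgreeF`-agreeing configurations give the same factor, p. 413 «it depends on U restricted to X̃⁵»); HYPOTHESES on the
letters. [cite: Balaban1985BackgroundPropagators, Cor. 3.8 p.410 L14–15, p.413, Thm 3.10 p.416] -/
theorem locality310_ops310WalkYO (near : ↥(cubes x.toKIdx.D.toDomains) → Finset (SiteY x.toKIdx)) (AgreeF : A → B.Cfg → B.Cfg → Prop)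
    (hOc : ∀ (c : ↥(cubes x.toKIdx.D.toDomains)) (U U' : B.Cfg), agree310WalkYO x B cfg near c U U' → Oc c (cfg U) = Oc c (cfg U'))
    (hRf : ∀ (a : A) (U U' : B.Cfg), AgreeF a U U' → Rf U a = Rf U' a) :
    Locality310 (ops310WalkYO x b B cfg bI GA Oc Δa Rf Rt SF) (rd310WalkYO x B cfg (κ := κ) near AgreeF) := by
  refine ⟨fun c U U' hA => ?_, fun a U U' hA => hRf a U U' hA⟩
  have hA' : agree310WalkYO x B cfg near c U U' := hA
  show mulOp (hWalkBY x c) * GcoK x.toKIdx b B cfg (Oc c) U * mulOp (hWalkBY x c) = mulOp (hWalkBY x c) * GcoK x.toKIdx b B cfg (Oc c) U' * mulOp (hWalkBY x c)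
  rw [GcoK, GcoK, hOc c U U' hA']

end Literature.MathematicalPhysics.QuantumFieldTheory.Balaban1983to89.B9WalkLettersOps310Facts

end
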